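import Summits.RiemannHypothesis.RiemannHypothesis.Theorems.SignConeSignConeOscillatoryStubExtremalExistsLsc
import Summits.RiemannHypothesis.RiemannHypothesis.Theorems.SignConeSignConeOscillatoryDensityMollify
import Literature.NumberTheory.LFunctions.WeilDilationVirial
import Mathlib.Analysis.SpecialFunctions.Trigonometric.Bounds

/-!
# Crux `SignCone.SignConeOscillatory` (stmt-RiemannHypothesis-16302), line `dual_witness` — density in energy, III:
# the log-weighted energy along dilate-then-mollify approximants

Third step of the density-in-energy lemma (parts I–II: `…DensityDilation.lean`, `…DensityMollify.lean`).  With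
`ρ(t) = Re ψ(1/4 + it/2)` (`reDigammaQuarter`) the archimedean energy of `g` is `∫ |ĝ(½+it)|² ρ(t) dt`.  For the
approximants `g = (weilDilate η u) ⋆ φₖ` of a window function `u ∈ L²` one has
`|ĝ(½+it)|² = (1+η)⁻¹ |û(½ + it/(1+η))|² |φ̂ₖ(½+it)|²`, so after `t = (1+η)s` the energy is
`∫ |û(½+is)|² |φ̂ₖ(½+i(1+η)s)|² ρ((1+η)s) ds`, and along `ηⱼ → 0⁺`, `kⱼ → ∞` it tends to the energy of `u` by
dominated convergence: `φ̂ₖ(½+iσ) → 1` locally uniformly (`|φ̂ₖ(½+iσ) - 1| ≤ |σ|·rₖ`), `ρ` is continuous, and the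
dilated weight is dominated through the monotonicity of `ρ` in `|t|` and the termwise DOUBLING BOUND
`ρ(2t) - ρ(0) ≤ 4 (ρ(t) - ρ(0))` of Yoshida's vertical series.  Requires only the finiteness of the energy of `u`.
-/

noncomputable section

-- `Summit.RiemannHypothesis.RiemannHypothesis.…` repeats a namespace component by design (D-0017 layout).
set_option linter.dupNamespace false

open scoped BigOperators ComplexConjugate Topology ENNReal
open MeasureTheory Set Filter Complex

namespace Summit.RiemannHypothesis.RiemannHypothesis.Theorems.SignCone.DualWitness

open Literature.NumberTheory.LFunctions Literature.Analysis.SpecialFunctions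

/-! ## The mollifier's transform is locally uniformly close to `1` -/

/-- **`|φ̂ₖ(½+iσ) - 1| ≤ |σ| · rₖ`**, `rₖ = 1/(k+1)` the radius of `φₖ = WeilContinuous.moll k`
(`φ̂ₖ(½+iσ) - 1 = ∫ φₖ(x)(e^{iσx} - 1) dx`, `|e^{iθ} - 1| ≤ |θ|`, `∫ φₖ = 1`). [folklore] -/
theorem norm_weilMellin_moll_half_sub_one_le (k : ℕ) (σ : ℝ) :
    ‖weilMellin (WeilContinuous.moll k) (1 / 2 + σ * I) - 1‖ ≤ |σ| * (WeilContinuous.bump k).rOut := by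
  set r : ℝ := (WeilContinuous.bump k).rOut with hr
  have hr0 : 0 < r := (WeilContinuous.bump k).rOut_pos
  have hφi : Integrable (WeilContinuous.moll k) :=
    (WeilContinuous.continuous_moll k).integrable_of_hasCompactSupport (WeilContinuous.hasCompactSupport_moll k)
  have hker : Continuous fun x : ℝ => cexp ((1 / 2 + σ * I - 1 / 2) * x) := by fun_prop
  have hI1 : Integrable fun x : ℝ => WeilContinuous.moll k x * cexp ((1 / 2 + σ * I - 1 / 2) * x) :=
    ((WeilContinuous.continuous_moll k).mul hker).integrable_of_hasCompactSupport
      (WeilContinuous.hasCompactSupport_moll k).mul_right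
  have hdiff : weilMellin (WeilContinuous.moll k) (1 / 2 + σ * I) - 1 =
      ∫ x : ℝ, WeilContinuous.moll k x * (cexp ((1 / 2 + σ * I - 1 / 2) * x) - 1) := by
    have e : (fun x : ℝ => WeilContinuous.moll k x * (cexp ((1 / 2 + σ * I - 1 / 2) * x) - 1)) =
        fun x => WeilContinuous.moll k x * cexp ((1 / 2 + σ * I - 1 / 2) * x) - WeilContinuous.moll k x := by
      funext x; ring
    rw [e, integral_sub hI1 hφi, WeilContinuous.integral_moll]
    rfl
  rw [hdiff]
  calc ‖∫ x : ℝ, WeilContinuous.moll k x * (cexp ((1 / 2 + σ * I - 1 / 2) * x) - 1)‖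
      ≤ ∫ x : ℝ, ‖WeilContinuous.moll k x * (cexp ((1 / 2 + σ * I - 1 / 2) * x) - 1)‖ :=
        norm_integral_le_integral_norm _
    _ ≤ ∫ x : ℝ, ‖WeilContinuous.moll k x‖ * (|σ| * r) := by
        refine integral_mono_of_nonneg (Eventually.of_forall fun _ => norm_nonneg _)
          ((WeilContinuous.integrable_norm_moll k).mul_const _) (Eventually.of_forall fun x => ?_)
        simp only
        rw [norm_mul]
        rcases le_or_gt r |x| with hx | hx
        · rw [WeilContinuous.moll_eq_zero hx]; simp
        · refine mul_le_mul_of_nonneg_left ?_ (norm_nonneg _)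
          have e : (1 / 2 + (σ : ℂ) * I - 1 / 2) * x = Complex.I * ((σ * x : ℝ) : ℂ) := by push_cast; ring
          rw [e]
          refine le_trans Real.norm_exp_I_mul_ofReal_sub_one_le ?_
          rw [Real.norm_eq_abs, abs_mul]
          exact mul_le_mul_of_nonneg_left hx.le (abs_nonneg _)
    _ = |σ| * r := by rw [MeasureTheory.integral_mul_const, WeilContinuous.integral_norm_moll, one_mul]

/-- Hence **`φ̂_{kⱼ}(½+iσⱼ) → 1`** whenever `σⱼ` stays bounded and `r_{kⱼ} → 0`. [folklore] -/
theorem tendsto_weilMellin_moll_half_of_bounded {σ : ℕ → ℝ} {k : ℕ → ℕ} {S : ℝ} (hσ : ∀ j, |σ j| ≤ S)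
    (hk : Tendsto (fun j => (WeilContinuous.bump (k j)).rOut) atTop (𝓝 0)) :
    Tendsto (fun j => weilMellin (WeilContinuous.moll (k j)) (1 / 2 + σ j * I)) atTop (𝓝 1) := by
  rw [tendsto_iff_norm_sub_tendsto_zero]
  have hS : 0 ≤ S := (abs_nonneg _).trans (hσ 0)
  refine squeeze_zero (fun j => norm_nonneg _) (fun j => (norm_weilMellin_moll_half_sub_one_le (k j) (σ j)).trans
    (mul_le_mul_of_nonneg_right (hσ j) (WeilContinuous.bump (k j)).rOut_pos.le)) ?_
  simpa using hk.const_mul S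

/-! ## The dilated weight: monotonicity and the doubling bound -/

/-- Termwise doubling: `f_l(2t) ≤ 4 f_l(t)` for the terms `f_l(t) = 2t²/(l(l²+t²))` of the vertical series. [folklore] -/
theorem digammaTerm_two_mul_le {l : ℝ} (hl : 0 < l) (t : ℝ) : digammaTerm l (2 * t) ≤ 4 * digammaTerm l t := by
  unfold digammaTerm
  have h1 : 0 < l * (l ^ 2 + (2 * t) ^ 2) := by positivity
  have h2 : 0 < l * (l ^ 2 + t ^ 2) := by positivity
  rw [show 4 * (2 * t ^ 2 / (l * (l ^ 2 + t ^ 2))) = 8 * t ^ 2 / (l * (l ^ 2 + t ^ 2)) by ring,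
    div_le_div_iff₀ h1 h2]
  nlinarith [mul_nonneg hl.le (pow_nonneg (sq_nonneg t) 2), sq_nonneg t]

/-- **Doubling bound** `ρ(2t) - ρ(0) ≤ 4 (ρ(t) - ρ(0))` (sum the termwise bound over Yoshida's series). [folklore] -/
theorem reDigammaQuarter_two_mul_le (t : ℝ) :
    reDigammaQuarter (2 * t) - reDigammaQuarter 0 ≤ 4 * (reDigammaQuarter t - reDigammaQuarter 0) := by
  have h2 := hasSum_digammaTerm (2 * t)
  have h1 := (hasSum_digammaTerm t).mul_left 4
  exact hasSum_le (fun m => digammaTerm_two_mul_le (digammaNode_pos m) t) h2 h1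

/-- **Domination of the dilated weight**: for `1 ≤ c ≤ 2`, `|ρ(c t)| ≤ 5 |ρ(t)| + 3 |ρ(0)|`. [folklore] -/
theorem abs_reDigammaQuarter_mul_le {c : ℝ} (hc1 : 1 ≤ c) (hc2 : c ≤ 2) (t : ℝ) :
    |reDigammaQuarter (c * t)| ≤ 5 * |reDigammaQuarter t| + 3 * |reDigammaQuarter 0| := by
  have hc0 : (0 : ℝ) < c := by linarith
  have hlo : reDigammaQuarter t ≤ reDigammaQuarter (c * t) :=
    reDigammaQuarter_mono (by rw [abs_mul, abs_of_pos hc0]; exact le_mul_of_one_le_left (abs_nonneg t) hc1)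
  have hhi : reDigammaQuarter (c * t) ≤ reDigammaQuarter (2 * t) :=
    reDigammaQuarter_mono (by
      rw [abs_mul, abs_mul, abs_of_pos hc0, abs_two]
      exact mul_le_mul_of_nonneg_right hc2 (abs_nonneg t))
  have hd := reDigammaQuarter_two_mul_le t
  have h1 := neg_abs_le (reDigammaQuarter t)
  have h2 := le_abs_self (reDigammaQuarter t)
  have h3 := neg_abs_le (reDigammaQuarter 0)
  have h4 := le_abs_self (reDigammaQuarter 0)
  have h5 := abs_nonneg (reDigammaQuarter t)
  have h6 := abs_nonneg (reDigammaQuarter 0)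
  rw [abs_le]
  constructor <;> linarith

/-! ## The energy of the approximants -/

variable {a : ℝ} {u : ℝ → ℂ}

/-- The critical-line transform of `(weilDilate η u) ⋆ φₖ` in closed form:
`|ĝ(½+it)|² = (1+η)⁻¹ |û(½ + it/(1+η))|² |φ̂ₖ(½+it)|²` (`η > -1`, `u` integrable and compactly supported). [folklore] -/
theorem norm_sq_weilMellin_approx (hi : Integrable u) {η : ℝ} (hη : -1 < η) (k : ℕ) (t : ℝ) :
    ‖weilMellin (weilConv (weilDilate η u) (WeilContinuous.moll k)) (1 / 2 + t * I)‖ ^ 2 =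
      (1 + η)⁻¹ * ‖weilMellin u (1 / 2 + (t / (1 + η) : ℝ) * I)‖ ^ 2 *
        ‖weilMellin (WeilContinuous.moll k) (1 / 2 + t * I)‖ ^ 2 := by
  have hc : 0 < 1 + η := by linarith
  have hdi : Integrable (weilDilate η u) := by
    have h := hi.comp_mul_left' (R := 1 + η) hc.ne'
    exact (h.const_mul ((Real.sqrt (1 + η) : ℂ))).congr (Eventually.of_forall fun t => rfl)
  have hφ : Integrable (WeilContinuous.moll k) :=
    (WeilContinuous.continuous_moll k).integrable_of_hasCompactSupport (WeilContinuous.hasCompactSupport_moll k)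
  have hconv : weilMellin (weilConv (weilDilate η u) (WeilContinuous.moll k)) (1 / 2 + t * I) =
      weilMellin (weilDilate η u) (1 / 2 + t * I) * weilMellin (WeilContinuous.moll k) (1 / 2 + t * I) := by
    rw [weilMellin_half_eq_fourier, weilMellin_half_eq_fourier, weilMellin_half_eq_fourier, weilConv,
      Real.fourier_mul_convolution_eq hdi hφ]
  have hdil : weilMellin (weilDilate η u) (1 / 2 + t * I) =
      (Real.sqrt (1 + η) : ℂ) * ((1 + η : ℝ) : ℂ)⁻¹ * weilMellin u (1 / 2 + (t / (1 + η) : ℝ) * I) := by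
    rw [weilMellin_weilDilate u hη]
    congr 2
    push_cast
    field_simp
    ring
  rw [hconv, hdil, norm_mul, norm_mul, norm_mul, mul_pow, mul_pow, mul_pow, Complex.norm_real,
    Real.norm_of_nonneg (Real.sqrt_nonneg _), Real.sq_sqrt hc.le, norm_inv, Complex.norm_real,
    Real.norm_of_nonneg hc.le, inv_pow]
  field_simp

/-- **Convergence of the energies along `ηⱼ → 0⁺`, `r_{kⱼ} → 0`**: if `u ∈ L¹` has finite log-weighted energy and
`|û(½+it)|²` is integrable, then
`∫ |(weilDilate ηⱼ u ⋆ φ_{kⱼ})^(½+it)|² ρ(t) dt → ∫ |û(½+it)|² ρ(t) dt`. [folklore] -/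
theorem tendsto_energy_approx (hi : Integrable u)
    (hU : Integrable fun t : ℝ => ‖weilMellin u (1 / 2 + t * I)‖ ^ 2)
    (hE : Integrable fun t : ℝ => ‖weilMellin u (1 / 2 + t * I)‖ ^ 2 * reDigammaQuarter t)
    {η : ℕ → ℝ} {k : ℕ → ℕ} (hη0 : ∀ j, 0 < η j) (hη1 : ∀ j, η j ≤ 1) (hηlim : Tendsto η atTop (𝓝 0))
    (hk : Tendsto (fun j => (WeilContinuous.bump (k j)).rOut) atTop (𝓝 0)) :
    Tendsto (fun j => ∫ t : ℝ, ‖weilMellin (weilConv (weilDilate (η j) u) (WeilContinuous.moll (k j)))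
        (1 / 2 + t * I)‖ ^ 2 * reDigammaQuarter t) atTop
      (𝓝 (∫ t : ℝ, ‖weilMellin u (1 / 2 + t * I)‖ ^ 2 * reDigammaQuarter t)) := by
  set U : ℝ → ℝ := fun s => ‖weilMellin u (1 / 2 + s * I)‖ ^ 2 with hUdef
  set ρ : ℝ → ℝ := reDigammaQuarter with hρ
  -- the substituted integrands
  set G : ℕ → ℝ → ℝ := fun j s =>
    U s * ‖weilMellin (WeilContinuous.moll (k j)) (1 / 2 + ((1 + η j) * s : ℝ) * I)‖ ^ 2 * ρ ((1 + η j) * s) with hG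
  -- Step 1: change of variables `t = (1 + η) s`
  have hsub : ∀ j, ∫ t : ℝ, ‖weilMellin (weilConv (weilDilate (η j) u) (WeilContinuous.moll (k j)))
      (1 / 2 + t * I)‖ ^ 2 * ρ t = ∫ s, G j s := by
    intro j
    have hc : 0 < 1 + η j := by linarith [hη0 j]
    have e1 : (fun t : ℝ => ‖weilMellin (weilConv (weilDilate (η j) u) (WeilContinuous.moll (k j)))
        (1 / 2 + t * I)‖ ^ 2 * ρ t) = fun t => (1 + η j)⁻¹ * G j (t / (1 + η j)) := by
      funext t
      rw [norm_sq_weilMellin_approx hi (by linarith [hη0 j]) (k j) t]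
      simp only [hG, hUdef]
      rw [mul_div_cancel₀ _ hc.ne']
      ring
    rw [e1, integral_const_mul, Measure.integral_comp_div (fun s => G j s) (1 + η j), smul_eq_mul,
      abs_of_pos hc, ← mul_assoc, inv_mul_cancel₀ hc.ne', one_mul]
  simp_rw [hsub]
  -- Step 2: dominated convergence for `∫ G j`
  have hUcont : Continuous U := by
    simp only [hUdef]
    exact ((dens_continuous_weilMellin_half hi).norm).pow 2
  have hU0 : ∀ s, 0 ≤ U s := fun s => by simp only [hUdef]; positivity
  have hφi : ∀ j, Integrable (WeilContinuous.moll (k j)) := fun j =>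
    (WeilContinuous.continuous_moll (k j)).integrable_of_hasCompactSupport (WeilContinuous.hasCompactSupport_moll (k j))
  have hGmeas : ∀ j, AEStronglyMeasurable (G j) volume := by
    intro j
    refine Continuous.aestronglyMeasurable ?_
    simp only [hG]
    refine (hUcont.mul ?_).mul (continuous_reDigammaQuarter.comp (continuous_const.mul continuous_id))
    have h1 : Continuous fun s : ℝ => weilMellin (WeilContinuous.moll (k j)) (1 / 2 + (((1 + η j) * s : ℝ) : ℂ) * I) :=
      (dens_continuous_weilMellin_half (hφi j)).comp (continuous_const.mul continuous_id)
    exact (h1.norm).pow 2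
  -- the bound
  set B : ℝ → ℝ := fun s => U s * (5 * |ρ s| + 3 * |ρ 0|) with hB
  have hBint : Integrable B := by
    have h1 : Integrable fun s => U s * |ρ s| := by
      refine (hE.norm).congr (Eventually.of_forall fun s => ?_)
      simp only [hUdef, hρ]
      rw [Real.norm_eq_abs, abs_mul, abs_of_nonneg (by positivity)]
    have h2 : Integrable fun s => 5 * (U s * |ρ s|) + 3 * |ρ 0| * U s := (h1.const_mul 5).add (hU.const_mul _)
    refine h2.congr (Eventually.of_forall fun s => ?_)
    simp only [hB]
    ring
  have hbound : ∀ j, ∀ᵐ s ∂volume, ‖G j s‖ ≤ B s := by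
    intro j
    refine Eventually.of_forall fun s => ?_
    have hc1 : (1 : ℝ) ≤ 1 + η j := by linarith [hη0 j]
    have hc2 : 1 + η j ≤ 2 := by linarith [hη1 j]
    have hφ1 : ‖weilMellin (WeilContinuous.moll (k j)) (1 / 2 + (((1 + η j) * s : ℝ) : ℂ) * I)‖ ^ 2 ≤ 1 := by
      have h := WeilContinuous.norm_weilMellin_moll_half_le (k j) ((1 + η j) * s)
      have h0 := norm_nonneg (weilMellin (WeilContinuous.moll (k j)) (1 / 2 + (((1 + η j) * s : ℝ) : ℂ) * I))
      nlinarith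
    have hρb := abs_reDigammaQuarter_mul_le hc1 hc2 s
    simp only [hG, hB]
    rw [Real.norm_eq_abs, abs_mul, abs_mul, abs_of_nonneg (hU0 s), abs_of_nonneg (by positivity)]
    calc U s * ‖weilMellin (WeilContinuous.moll (k j)) (1 / 2 + (((1 + η j) * s : ℝ) : ℂ) * I)‖ ^ 2 *
          |ρ ((1 + η j) * s)|
        ≤ U s * 1 * (5 * |ρ s| + 3 * |ρ 0|) := by
          apply mul_le_mul (mul_le_mul_of_nonneg_left hφ1 (hU0 s)) hρb (abs_nonneg _)
          exact mul_nonneg (hU0 s) zero_le_one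
      _ = U s * (5 * |ρ s| + 3 * |ρ 0|) := by ring
  -- the pointwise limit
  have hlim : ∀ᵐ s ∂volume, Tendsto (fun j => G j s) atTop (𝓝 (U s * ρ s)) := by
    refine Eventually.of_forall fun s => ?_
    have hσ : ∀ j, |(1 + η j) * s| ≤ 2 * |s| := fun j => by
      rw [abs_mul, abs_of_pos (by linarith [hη0 j])]
      exact mul_le_mul_of_nonneg_right (by linarith [hη1 j]) (abs_nonneg s)
    have h1 := tendsto_weilMellin_moll_half_of_bounded (σ := fun j => (1 + η j) * s) hσ hk
    have h1' : Tendsto (fun j => ‖weilMellin (WeilContinuous.moll (k j)) (1 / 2 + (((1 + η j) * s : ℝ) : ℂ) * I)‖ ^ 2)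
        atTop (𝓝 1) := by
      have := (h1.norm).pow 2
      simpa using this
    have h2 : Tendsto (fun j => ρ ((1 + η j) * s)) atTop (𝓝 (ρ s)) := by
      have hc : Tendsto (fun j => (1 + η j) * s) atTop (𝓝 ((1 + 0) * s)) :=
        (tendsto_const_nhds.add hηlim).mul tendsto_const_nhds
      rw [add_zero, one_mul] at hc
      exact (continuous_reDigammaQuarter.tendsto _).comp hc
    have h3 := (tendsto_const_nhds (x := U s)).mul (h1'.mul h2)
    rw [one_mul] at h3
    refine h3.congr fun j => ?_
    simp only [hG]; ring
  exact tendsto_integral_of_dominated_convergence B hGmeas hBint hbound hlim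

/-- Anchor of this file on the crux item (registered sub-goal): the doubling bound of the archimedean weight
(`reDigammaQuarter_two_mul_le`, `∀`-form). [folklore] -/
theorem density_doubling : ∀ t : ℝ, reDigammaQuarter (2 * t) - reDigammaQuarter 0 ≤ 4 * (reDigammaQuarter t - reDigammaQuarter 0) :=
  fun t => reDigammaQuarter_two_mul_le t

end Summit.RiemannHypothesis.RiemannHypothesis.Theorems.SignCone.DualWitness

end
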